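import Mathlib
import Summits.QuantumFields.QCD.Theorems.WilsonQuarkChessboardBackgroundSchwarzGram

/-!
# Defect removal: `det (1 + Y S Yᴴ) ≤ (∏ max(σᵢ(S), 1)) · det (1 + Y Yᴴ)` for `S ⪰ 0`
(helper for crux stmt-QuantumFields-9734, line `Sketch`, static route, stub `stub_heavyFrequencyGain`, Route B step B3)

For a positive semidefinite `S` with eigenvalues `σᵢ` and any rectangular `Y`:
`det (1 + Y S Yᴴ) ≤ (∏ᵢ max(σᵢ, 1)) · det (1 + Y Yᴴ)` (both sides real and positive).
Proof: clip the spectrum, `S ≤ S₊ := V diag(max(σ,1)) V⋆`, so `Y S Yᴴ ≤ Y S₊ Yᴴ` and `det (1 + ·)` is monotone on the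
positive cone (`det_le_det_add`); with `R = S₊^{1/2}` (explicit: `V diag(√max(σ,1)) V⋆`), Sylvester's identity gives
`det (1 + Y S₊ Yᴴ) = det (1 + R YᴴY R)`, and `1 + R YᴴY R ≤ R (1 + YᴴY) R` because `R R - 1 = S₊ - 1 ⪰ 0`; finally
`det (R (1 + YᴴY) R) = det S₊ · det (1 + YᴴY) = (∏ max(σᵢ,1)) · det (1 + Y Yᴴ)`.
In the transfer-matrix form of the 2D frequency determinant this removes the STATIC DEFECT SLAB `S = A_kᴴ A_k` created by the
mixed (site/bond) reflection of an odd cycle, at the price of its pressure `∏ max(σᵢ,1) = ‖Γ(S)‖`.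
-/

namespace Summit.QuantumFields.QCD.Cruxes.CriticalLineDiamagnetism.ChessboardCellGain

open Matrix Summit.QuantumFields.QCD.Theorems.BackgroundSchwarz
open scoped ComplexOrder MatrixOrder ComplexConjugate

variable {m n : Type} [Fintype m] [Fintype n] [DecidableEq m] [DecidableEq n]

/-- A real diagonal matrix with non-negative entries, conjugated by any matrix `V`, is positive semidefinite:
`V diag(d) Vᴴ ⪰ 0` for `d ≥ 0`. -/
theorem posSemidef_conj_diagonal (V : Matrix n n ℂ) {d : n → ℝ} (hd : ∀ i, 0 ≤ d i) :
    (V * diagonal (fun i => ((d i : ℝ) : ℂ)) * Vᴴ).PosSemidef := by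
  have hD : (diagonal (fun i => ((d i : ℝ) : ℂ))).PosSemidef :=
    PosSemidef.diagonal fun i => by
      rw [Pi.zero_apply]
      exact Complex.zero_le_real.mpr (hd i)
  exact hD.mul_mul_conjTranspose_same V

/-- **Defect removal.** For `S ⪰ 0` with eigenvalues `σᵢ` and any `Y`:
`det (1 + Y S Yᴴ) ≤ (∏ᵢ max(σᵢ, 1)) · det (1 + Y Yᴴ)` in the order of `ℂ` (both sides are real). -/
theorem det_one_add_mul_mul_conjTranspose_le : ∀ {m n : Type} [Fintype m] [Fintype n] [DecidableEq m] [DecidableEq n] (Y : Matrix m n ℂ) (S : Matrix n n ℂ) (hS : S.PosSemidef), (1 + Y * S * Yᴴ).det ≤ (∏ i, ((max (hS.1.eigenvalues i) 1 : ℝ) : ℂ)) * (1 + Y * Yᴴ).det := by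
  intro m n _ _ _ _ Y S hS
  classical
  -- spectral data of `S`
  set V : Matrix n n ℂ := (hS.1.eigenvectorUnitary : Matrix n n ℂ) with hVdef
  have hVsV : star V * V = 1 := Unitary.star_mul_self_of_mem hS.1.eigenvectorUnitary.prop
  have hVVs : V * star V = 1 := Unitary.mul_star_self_of_mem hS.1.eigenvectorUnitary.prop
  set σ : n → ℝ := hS.1.eigenvalues with hσdef
  have hS_eq : S = V * diagonal (fun i => ((σ i : ℝ) : ℂ)) * star V := by
    have h := hS.1.spectral_theorem
    rw [Unitary.conjStarAlgAut_apply] at h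
    have hfun : (RCLike.ofReal ∘ hS.1.eigenvalues : n → ℂ) = fun i => ((σ i : ℝ) : ℂ) := by
      funext i; rfl
    rw [hfun] at h
    exact h
  -- clipped spectrum and its square root
  set μ : n → ℝ := fun i => max (σ i) 1 with hμdef
  set r : n → ℝ := fun i => Real.sqrt (μ i) with hrdef
  have hμ1 : ∀ i, 1 ≤ μ i := fun i => le_max_right _ _
  have hμ0 : ∀ i, 0 ≤ μ i := fun i => le_trans zero_le_one (hμ1 i)
  have hrr : ∀ i, r i * r i = μ i := fun i => Real.mul_self_sqrt (hμ0 i)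
  set Dμ : Matrix n n ℂ := diagonal (fun i => ((μ i : ℝ) : ℂ)) with hDμ
  set Dr : Matrix n n ℂ := diagonal (fun i => ((r i : ℝ) : ℂ)) with hDr
  set Sp : Matrix n n ℂ := V * Dμ * star V with hSp
  set R : Matrix n n ℂ := V * Dr * star V with hR
  have hDrDr : Dr * Dr = Dμ := by
    rw [hDr, hDμ, diagonal_mul_diagonal]
    congr 1; funext i
    rw [← Complex.ofReal_mul, hrr i]
  have hRR : R * R = Sp := by
    rw [hR, hSp, Matrix.mul_assoc (V * Dr) (star V) (V * Dr * star V), ← Matrix.mul_assoc (star V) (V * Dr) (star V),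
      ← Matrix.mul_assoc (star V) V Dr, hVsV, Matrix.one_mul, ← Matrix.mul_assoc (V * Dr) Dr (star V),
      Matrix.mul_assoc V Dr Dr, hDrDr]
  have hDrH : Drᴴ = Dr := by
    rw [hDr, diagonal_conjTranspose]
    congr 1; funext i; simp [Complex.conj_ofReal]
  have hRH : Rᴴ = R := by
    rw [hR, conjTranspose_mul, conjTranspose_mul, hDrH, star_eq_conjTranspose, conjTranspose_conjTranspose,
      Matrix.mul_assoc]
  -- (1) `S ≤ S₊`: `Y (S₊ - S) Yᴴ ⪰ 0`
  have hdiff : Sp - S = V * diagonal (fun i => (((μ i - σ i : ℝ) : ℝ) : ℂ)) * Vᴴ := by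
    rw [hSp, hS_eq, star_eq_conjTranspose, ← Matrix.sub_mul, ← Matrix.mul_sub, hDμ, diagonal_sub]
    congr 2; funext i; push_cast; ring
  have hPSD1 : (Y * (Sp - S) * Yᴴ).PosSemidef := by
    rw [hdiff]
    have h := posSemidef_conj_diagonal V (d := fun i => μ i - σ i) (fun i => sub_nonneg.2 (le_max_left _ _))
    exact h.mul_mul_conjTranspose_same Y
  have hPSD0 : (1 + Y * S * Yᴴ).PosSemidef := PosSemidef.one.add (hS.mul_mul_conjTranspose_same Y)
  have step1 : (1 + Y * S * Yᴴ).det ≤ (1 + Y * Sp * Yᴴ).det := by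
    have h := det_le_det_add hPSD0 hPSD1
    have halg : 1 + Y * S * Yᴴ + Y * (Sp - S) * Yᴴ = 1 + Y * Sp * Yᴴ := by
      rw [Matrix.mul_sub, Matrix.sub_mul]; abel
    rwa [halg] at h
  -- (2) Sylvester: `det (1 + Y S₊ Yᴴ) = det (1 + R (YᴴY) R)`
  have step2 : (1 + Y * Sp * Yᴴ).det = (1 + R * (Yᴴ * Y) * R).det := by
    rw [← hRR, show Y * (R * R) * Yᴴ = (Y * R) * (R * Yᴴ) by
          simp only [Matrix.mul_assoc], det_one_add_mul_comm]
    congr 1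
    simp only [Matrix.mul_assoc]
  -- (3) `1 + R YᴴY R ≤ R (1 + YᴴY) R`, difference `R R - 1 = S₊ - 1 ⪰ 0`
  have hPSD2 : (1 + R * (Yᴴ * Y) * R).PosSemidef := by
    have hG : (Yᴴ * Y).PosSemidef := posSemidef_conjTranspose_mul_self Y
    have h := hG.mul_mul_conjTranspose_same R
    rw [hRH] at h
    exact PosSemidef.one.add h
  have hPSD3 : (Sp - 1).PosSemidef := by
    have h1 : Sp - 1 = V * diagonal (fun i => (((μ i - 1 : ℝ) : ℝ) : ℂ)) * Vᴴ := by
      rw [hSp, star_eq_conjTranspose, hDμ]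
      have hone : (1 : Matrix n n ℂ) = V * diagonal (fun _ => (((1 : ℝ) : ℝ) : ℂ)) * Vᴴ := by
        rw [show (diagonal fun _ : n => (((1 : ℝ) : ℝ) : ℂ)) = 1 by simp, Matrix.mul_one, ← star_eq_conjTranspose, hVVs]
      rw [hone, ← Matrix.sub_mul, ← Matrix.mul_sub, diagonal_sub]
      congr 2; funext i; push_cast; ring
    rw [h1]
    exact posSemidef_conj_diagonal V (d := fun i => μ i - 1) (fun i => sub_nonneg.2 (hμ1 i))
  have step3 : (1 + R * (Yᴴ * Y) * R).det ≤ (R * (1 + Yᴴ * Y) * R).det := by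
    have h := det_le_det_add hPSD2 hPSD3
    have halg : 1 + R * (Yᴴ * Y) * R + (Sp - 1) = R * (1 + Yᴴ * Y) * R := by
      rw [← hRR, Matrix.mul_add, Matrix.add_mul, Matrix.mul_one]; abel
    rwa [halg] at h
  -- (4) `det (R (1 + YᴴY) R) = det S₊ · det (1 + Y Yᴴ)` and `det S₊ = ∏ μᵢ`
  have hdetSp : Sp.det = ∏ i, ((μ i : ℝ) : ℂ) := by
    rw [hSp, det_mul, det_mul, hDμ, det_diagonal]
    have hV1 : V.det * (star V).det = 1 := by rw [← det_mul, hVVs, det_one]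
    calc V.det * (∏ i, ((μ i : ℝ) : ℂ)) * (star V).det = (V.det * (star V).det) * ∏ i, ((μ i : ℝ) : ℂ) := by ring
      _ = ∏ i, ((μ i : ℝ) : ℂ) := by rw [hV1, one_mul]
  have hRd : R.det * R.det = ∏ i, ((μ i : ℝ) : ℂ) := by rw [← det_mul, hRR, hdetSp]
  have hSyl : (1 + Yᴴ * Y).det = (1 + Y * Yᴴ).det := det_one_add_mul_comm Yᴴ Y
  have step4 : (R * (1 + Yᴴ * Y) * R).det = (∏ i, ((μ i : ℝ) : ℂ)) * (1 + Y * Yᴴ).det := by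
    rw [det_mul, det_mul, hSyl, ← hRd]; ring
  have h34 : (1 + R * (Yᴴ * Y) * R).det ≤ (∏ i, ((μ i : ℝ) : ℂ)) * (1 + Y * Yᴴ).det := step3.trans_eq step4
  rw [← step2] at h34
  exact step1.trans h34

end Summit.QuantumFields.QCD.Cruxes.CriticalLineDiamagnetism.ChessboardCellGain
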